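import Mathlib
import Summits.ValiantsHypothesis.ValiantsHypothesis.Theorems.NewtonFramesNewtonTauWeakBlockConvexThree
import Summits.ValiantsHypothesis.ValiantsHypothesis.Theorems.NewtonFramesCappedSlopeSum

/-!
# Crux `NewtonTauWeak` (stmt-ValiantsHypothesis-5904), line `low-parallelism`: the PARABOLA DICTIONARY and the GRID
WITNESS (Theorems-side port, crit-3 VERDICT #12 price P5; part 1 of 2)

The line `Cruxes/NewtonTauWeak/Lines/low_parallelism.lean` (val-idea-12 g2) localises the measured `7/3`-versus-`8/3`
deficit of `ThreeSetBound` (line `landing-collapse`) in its PARABOLIC case, where `Φ(x,y) = (x, y - x²)` turns the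
configuration into a CARTESIAN PRODUCT `A × B` (`#A, #B ≤ n`) against `≤ n²` non-vertical lines `y = μ x + ν`, the
convex-position output being the set of LANDINGS `a + μ/2` over the incidences.  This file lands, as helpers with
statements written out over tree-visible constants (no new definitions; in the line's vocabulary
`incTriples A B L = ((A ×ˢ B) ×ˢ L).filter (b = μ a + ν)`, `landings A B L = (incTriples A B L).image (a + μ/2)`,
`slopeMult L μ = #(L.filter (slope = μ))`):

* §1 counting: `card_ptsOn_le` (a non-vertical line meets `A × B` in `≤ #A` points), `card_incTriples_eq_sum`,
  `card_incTriples_pencil_le` (a PENCIL through one centre carries `≤ #A·#B + #L` incidences — rev 2 of the line: the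
  failure mode of its law needs many SIMULTANEOUSLY rich pencils);
* §2 `parabolaDictionary` — `ThreeSetBound → CartesianParabolaBound`, same `η`, `C` (`P₁ = {(a,a²)}`, `P₂ = {(0,b)}`,
  `Y = {(μ/2, μ²/4 - ν)}`, `S = {(x,x²) : x a landing}`; `BlockConvexThree.parabola_convexIndependent`): the
  Cartesian–parabola rung is a genuine special case of `ThreeSetBound`;
* §3 `gridWitness` — the line's `GridLowParallelism`, verbatim: on the grid `A = B = {0,…,n-1}` a line set with `≤ K`
  lines per slope has `≤ n (2H+1) H K + #L ((n-1)/(H+1) + 1)` incidences for every height cut `H`, from the landed rung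
  file `CappedSlopeSum` (`card_linePts_le`, `mem_lowSlopes`, p601033) — so the low-parallelism law holds with room
  (`O(K^{1/3} n^{7/3})`) exactly where `7/3` is attained.

The cap reduction `LowParallelismLaw → CartesianParabolaBound` is part 2 (`NewtonFramesLowParallelismCapReduction`).
Everything here is an implication between OPEN statements or an unconditional count; nothing proves
`LowParallelismLaw`, `CartesianParabolaBound`, `ThreeSetBound`, `BeatTwoThirds`, the crux `NewtonTauWeak`, or anything
about `VP ≠ VNP`.  Helper for the crux item (`--supports`); proofs are the line file's rev-2/rev-3 proofs, moved (names as in rev 3: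
`capReductionLanding`, `landingLaw_of_law`, `capReduction`, `landingLaw_iff_cartesianParabolaBound`, `parabolaDictionary`).
-/

set_option linter.dupNamespace false

namespace Summit.ValiantsHypothesis.ValiantsHypothesis.Theorems.NewtonFramesNewtonTauWeak.LowParallelism

open scoped BigOperators Pointwise

noncomputable section

/-! ### 1. Counting lemmas: `A × B` against non-vertical lines -/

/-- Points of `A × B` on one non-vertical line number at most `#A` (the abscissa determines the point). [folklore] -/
theorem card_ptsOn_le (A B : Finset ℝ) (s c : ℝ) :
    ((A ×ˢ B).filter fun x : ℝ × ℝ => x.2 = s * x.1 + c).card ≤ A.card := by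
  classical
  refine Finset.card_le_card_of_injOn Prod.fst (fun x hx => ?_) ?_
  · exact (Finset.mem_product.1 (Finset.mem_filter.1 hx).1).1
  · intro x hx x' hx' h
    have h1 := (Finset.mem_filter.1 (Finset.mem_coe.1 hx)).2
    have h2 := (Finset.mem_filter.1 (Finset.mem_coe.1 hx')).2
    exact Prod.ext h (by rw [h1, h2, h])

/-- The incidence count `I(A × B, L)` is the sum over the lines of the per-line point counts. [folklore] -/
theorem card_incTriples_eq_sum (A B : Finset ℝ) (L : Finset (ℝ × ℝ)) :
    (((A ×ˢ B) ×ˢ L).filter fun q : (ℝ × ℝ) × (ℝ × ℝ) => q.1.2 = q.2.1 * q.1.1 + q.2.2).card =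
      ∑ l ∈ L, ((A ×ˢ B).filter fun x : ℝ × ℝ => x.2 = l.1 * x.1 + l.2).card := by
  classical
  rw [Finset.card_filter, Finset.sum_product_right]
  refine Finset.sum_congr rfl fun l _ => ?_
  rw [Finset.card_filter]

/-- **PENCIL BOUND:** if every line of `L` passes through `z`, then `I(A × B, L) ≤ #A·#B + #L` — a point `≠ z` lies on
at most one line of the pencil (two lines through `z` and a second common point coincide), and `z` itself lies on `#L`
of them. [folklore] -/
theorem card_incTriples_pencil_le (A B : Finset ℝ) (L : Finset (ℝ × ℝ)) (z : ℝ × ℝ)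
    (hz : ∀ l ∈ L, z.2 = l.1 * z.1 + l.2) :
    (((A ×ˢ B) ×ˢ L).filter fun q : (ℝ × ℝ) × (ℝ × ℝ) => q.1.2 = q.2.1 * q.1.1 + q.2.2).card ≤
      A.card * B.card + L.card := by
  classical
  set I := ((A ×ˢ B) ×ˢ L).filter fun q : (ℝ × ℝ) × (ℝ × ℝ) => q.1.2 = q.2.1 * q.1.1 + q.2.2 with hI
  have hsplit := Finset.card_filter_add_card_filter_not (s := I) (p := fun q : (ℝ × ℝ) × (ℝ × ℝ) => q.1 = z)
  have h1 : (I.filter fun q : (ℝ × ℝ) × (ℝ × ℝ) => q.1 = z).card ≤ L.card := by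
    refine Finset.card_le_card_of_injOn (fun q => q.2) (fun q hq => ?_) ?_
    · exact (Finset.mem_product.1 (Finset.mem_filter.1 (Finset.mem_filter.1 hq).1).1).2
    · intro q hq q' hq' heq
      have h1 := (Finset.mem_filter.1 (Finset.mem_coe.1 hq)).2
      have h2 := (Finset.mem_filter.1 (Finset.mem_coe.1 hq')).2
      exact Prod.ext (h1.trans h2.symm) heq
  have h2 : (I.filter fun q : (ℝ × ℝ) × (ℝ × ℝ) => ¬ q.1 = z).card ≤ A.card * B.card := by
    rw [← Finset.card_product]
    refine Finset.card_le_card_of_injOn (fun q => q.1) (fun q hq => ?_) ?_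
    · exact (Finset.mem_product.1 (Finset.mem_filter.1 (Finset.mem_filter.1 hq).1).1).1
    · intro q hq q' hq' heq
      have hq1 := Finset.mem_filter.1 (Finset.mem_coe.1 hq)
      have hq'1 := Finset.mem_filter.1 (Finset.mem_coe.1 hq')
      have hi : q.1.2 = q.2.1 * q.1.1 + q.2.2 := (Finset.mem_filter.1 hq1.1).2
      have hi' : q'.1.2 = q'.2.1 * q'.1.1 + q'.2.2 := (Finset.mem_filter.1 hq'1.1).2
      have hl : q.2 ∈ L := (Finset.mem_product.1 (Finset.mem_filter.1 hq1.1).1).2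
      have hl' : q'.2 ∈ L := (Finset.mem_product.1 (Finset.mem_filter.1 hq'1.1).1).2
      have hzl := hz _ hl
      have hzl' := hz _ hl'
      have heq1 : q.1 = q'.1 := heq
      have hne : q.1.1 ≠ z.1 := by
        intro hx
        apply hq1.2
        refine Prod.ext hx ?_
        rw [hi, hx, hzl]
      have e1 : q.1.2 = q'.2.1 * q.1.1 + q'.2.2 := by rw [heq1]; exact hi'
      have hμ : q.2.1 = q'.2.1 := by
        have h0 : (q.2.1 - q'.2.1) * (q.1.1 - z.1) = 0 := by linear_combination e1 - hi + hzl - hzl'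
        rcases mul_eq_zero.1 h0 with h | h
        · exact sub_eq_zero.1 h
        · exact absurd (sub_eq_zero.1 h) hne
      have hν : q.2.2 = q'.2.2 := by linear_combination hzl' - hzl - z.1 * hμ
      exact Prod.ext heq1 (Prod.ext hμ hν)
  omega

/-! ### 2. On-path honesty: the parabola dictionary -/

/-- **The dictionary `Φ(x,y) = (x, y - x²)`:** `ThreeSetBound → CartesianParabolaBound` (same `η`, `C`).  Given
`A, B, L` put `P₁ = {(a,a²)}`, `P₂ = {(0,b)}`, `Y = {(μ/2, μ²/4 - ν)}`, `S = {(x,x²) : x a landing}`: then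
`#Y ≤ #L`, `S ⊆ P₁ + P₂ + Y` (an incidence `b = μa + ν` gives `(a + μ/2, (a + μ/2)²) = (a,a²) + (0,b) + (μ/2, μ²/4 - ν)`),
`S` is convexly independent (`BlockConvexThree.parabola_convexIndependent`) and `#S = #landings`. [folklore] -/
theorem parabolaDictionary
    (h : ∃ (η C : ℝ), 0 < η ∧
      ∀ (n : ℕ) (P₁ P₂ Y S : Finset (Fin 2 → ℝ)),
        P₁.card ≤ n → P₂.card ≤ n → Y.card ≤ n ^ 2 → S ⊆ P₁ + P₂ + Y →
          ConvexIndependent ℝ (Subtype.val : ↥(S : Set (Fin 2 → ℝ)) → (Fin 2 → ℝ)) →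
            (S.card : ℝ) ≤ C * ((n : ℝ) + 2) ^ ((8 : ℝ) / 3 - η)) :
    ∃ (η C : ℝ), 0 < η ∧ ∀ (n : ℕ) (A B : Finset ℝ) (L : Finset (ℝ × ℝ)),
      A.card ≤ n → B.card ≤ n → L.card ≤ n ^ 2 →
        (((((A ×ˢ B) ×ˢ L).filter fun q : (ℝ × ℝ) × (ℝ × ℝ) => q.1.2 = q.2.1 * q.1.1 + q.2.2).image
            fun q : (ℝ × ℝ) × (ℝ × ℝ) => q.1.1 + q.2.1 / 2).card : ℝ) ≤ C * ((n : ℝ) + 2) ^ ((8 : ℝ) / 3 - η) := by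
  classical
  obtain ⟨η, C, hη, h⟩ := h
  refine ⟨η, C, hη, ?_⟩
  intro n A B L hA hB hL
  set lands : Finset ℝ :=
    (((A ×ˢ B) ×ˢ L).filter fun q : (ℝ × ℝ) × (ℝ × ℝ) => q.1.2 = q.2.1 * q.1.1 + q.2.2).image
      fun q : (ℝ × ℝ) × (ℝ × ℝ) => q.1.1 + q.2.1 / 2 with hlands
  set pt : ℝ → (Fin 2 → ℝ) := fun x => ![x, x ^ 2] with hpt
  set P₁ : Finset (Fin 2 → ℝ) := A.image fun a => (![a, a ^ 2] : Fin 2 → ℝ) with hP₁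
  set P₂ : Finset (Fin 2 → ℝ) := B.image fun b => (![(0 : ℝ), b] : Fin 2 → ℝ) with hP₂
  set Y : Finset (Fin 2 → ℝ) := L.image fun l => (![l.1 / 2, l.1 ^ 2 / 4 - l.2] : Fin 2 → ℝ) with hY
  set S : Finset (Fin 2 → ℝ) := lands.image pt with hS
  have hP₁c : P₁.card ≤ n := Finset.card_image_le.trans hA
  have hP₂c : P₂.card ≤ n := Finset.card_image_le.trans hB
  have hYc : Y.card ≤ n ^ 2 := Finset.card_image_le.trans hL
  have hSsub : S ⊆ P₁ + P₂ + Y := by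
    intro s hs
    rw [hS, Finset.mem_image] at hs
    obtain ⟨x, hx, rfl⟩ := hs
    simp only [hlands, Finset.mem_image, Finset.mem_filter, Finset.mem_product] at hx
    obtain ⟨q, ⟨⟨⟨ha, hb⟩, hl⟩, heq⟩, rfl⟩ := hx
    have hp1 : (![q.1.1, q.1.1 ^ 2] : Fin 2 → ℝ) ∈ P₁ := Finset.mem_image.2 ⟨q.1.1, ha, rfl⟩
    have hp2 : (![(0 : ℝ), q.1.2] : Fin 2 → ℝ) ∈ P₂ := Finset.mem_image.2 ⟨q.1.2, hb, rfl⟩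
    have hy : (![q.2.1 / 2, q.2.1 ^ 2 / 4 - q.2.2] : Fin 2 → ℝ) ∈ Y := Finset.mem_image.2 ⟨q.2, hl, rfl⟩
    have hsum : pt (q.1.1 + q.2.1 / 2) =
        (![q.1.1, q.1.1 ^ 2] + ![(0 : ℝ), q.1.2]) + ![q.2.1 / 2, q.2.1 ^ 2 / 4 - q.2.2] := by
      simp only [hpt]
      funext k
      fin_cases k
      · simp
      · simp only [Fin.mk_one, Fin.isValue, Matrix.cons_val_one, Pi.add_apply, Matrix.cons_val_fin_one]
        rw [heq]; ring
    rw [hsum]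
    exact Finset.add_mem_add (Finset.add_mem_add hp1 hp2) hy
  have hSconv : ConvexIndependent ℝ (Subtype.val : ↥(S : Set (Fin 2 → ℝ)) → (Fin 2 → ℝ)) := by
    refine BlockConvexThree.parabola_convexIndependent _ fun s hs => ?_
    obtain ⟨x, _, rfl⟩ := Finset.mem_image.1 (Finset.mem_coe.1 hs)
    simp [hpt]
  have hScard : S.card = lands.card := by
    rw [hS]
    apply Finset.card_image_of_injective
    intro x x' hxx'
    have := congr_fun hxx' 0
    simpa [hpt] using this
  have hmain := h n P₁ P₂ Y S hP₁c hP₂c hYc hSsub hSconv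
  rw [hScard] at hmain
  exact hmain

/-! ### 3. The grid witness (the law on Farey's home turf, from the rung file `CappedSlopeSum`) -/

/-- **GRID WITNESS (`GridLowParallelism` of the line), verbatim:** on `A = B = {0,…,n-1}` a line set with `≤ K` lines
per slope has, for every height cut `H`, at most `n (2H+1) H K + #L ((n-1)/(H+1) + 1)` incidences: the slopes `a/b`
with `|a| ≤ H`, `1 ≤ b ≤ H` are `≤ (2H+1) H` in number (`CappedSlopeSum.mem_lowSlopes`), carry `≤ K` lines each of
`≤ n` points; every other line meets the grid in `≤ (n-1)/(H+1) + 1` points (`CappedSlopeSum.card_linePts_le`).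
With `K = n^{1/3+θ}`, `H = (n²/K)^{1/3}` this is `O(n^{22/9+θ/3}) ≤ n^{8/3-θ}` for `θ ≤ 1/6` (the Farey mechanism behind the
tight Minkowski-sum construction of Bílka et al. 2010, bib `BilkaEtAl2010`). [folklore] -/
theorem gridWitness : ∀ (n K H : ℕ) (L : Finset (ℝ × ℝ)),
    (∀ μ : ℝ, (L.filter fun l : ℝ × ℝ => l.1 = μ).card ≤ K) →
      (((((Finset.range n).image (fun i : ℕ => (i : ℝ))) ×ˢ ((Finset.range n).image (fun i : ℕ => (i : ℝ)))) ×ˢ L).filter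
          fun q : (ℝ × ℝ) × (ℝ × ℝ) => q.1.2 = q.2.1 * q.1.1 + q.2.2).card
        ≤ n * ((2 * H + 1) * H) * K + L.card * ((n - 1) / (H + 1) + 1) := by
  classical
  intro n K H L hK
  set A : Finset ℝ := (Finset.range n).image (fun i : ℕ => (i : ℝ)) with hAdef
  have hAcard : A.card ≤ n := Finset.card_image_le.trans (by simp)
  -- the low slopes
  set G : Finset ℝ := ((Finset.range (2 * H + 1)) ×ˢ (Finset.range H)).image
    (fun p : ℕ × ℕ => ((p.1 : ℝ) - H) / ((p.2 : ℝ) + 1)) with hG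
  have hGcard : G.card ≤ (2 * H + 1) * H := by
    refine Finset.card_image_le.trans ?_
    simp [Finset.card_product]
  set F : ℝ × ℝ → ℕ := fun l => ((A ×ˢ A).filter fun x : ℝ × ℝ => x.2 = l.1 * x.1 + l.2).card with hF
  rw [card_incTriples_eq_sum]
  change ∑ l ∈ L, F l ≤ _
  have hsplit := (Finset.sum_filter_add_sum_filter_not L (fun l => l.1 ∈ G) F).symm
  -- low-slope lines: at most `(2H+1)·H·K` of them, `≤ n` points each
  have hlow_card : (L.filter fun l => l.1 ∈ G).card ≤ ((2 * H + 1) * H) * K := by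
    have hsub : (L.filter fun l => l.1 ∈ G) ⊆ G.biUnion fun s => L.filter fun l => l.1 = s := by
      intro l hl
      rw [Finset.mem_filter] at hl
      exact Finset.mem_biUnion.2 ⟨l.1, hl.2, Finset.mem_filter.2 ⟨hl.1, rfl⟩⟩
    calc (L.filter fun l => l.1 ∈ G).card ≤ (G.biUnion fun s => L.filter fun l => l.1 = s).card :=
          Finset.card_le_card hsub
      _ ≤ ∑ s ∈ G, (L.filter fun l => l.1 = s).card := Finset.card_biUnion_le
      _ ≤ ∑ _s ∈ G, K := Finset.sum_le_sum fun s _ => hK s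
      _ = G.card * K := by rw [Finset.sum_const, smul_eq_mul]
      _ ≤ ((2 * H + 1) * H) * K := Nat.mul_le_mul_right K hGcard
  have hlow : ∑ l ∈ L.filter (fun l => l.1 ∈ G), F l ≤ n * ((2 * H + 1) * H) * K := by
    calc ∑ l ∈ L.filter (fun l => l.1 ∈ G), F l ≤ ∑ _l ∈ L.filter (fun l => l.1 ∈ G), n :=
          Finset.sum_le_sum fun l _ => (card_ptsOn_le A A l.1 l.2).trans hAcard
      _ = (L.filter fun l => l.1 ∈ G).card * n := by rw [Finset.sum_const, smul_eq_mul]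
      _ ≤ ((2 * H + 1) * H) * K * n := Nat.mul_le_mul_right n hlow_card
      _ = n * ((2 * H + 1) * H) * K := by ring
  -- high-slope lines: `≤ (n-1)/(H+1) + 1` points each
  have hhigh : ∑ l ∈ L.filter (fun l => ¬ l.1 ∈ G), F l ≤ L.card * ((n - 1) / (H + 1) + 1) := by
    have hper : ∀ l ∈ L.filter (fun l => ¬ l.1 ∈ G), F l ≤ (n - 1) / (H + 1) + 1 := by
      intro l hl
      have hlG : l.1 ∉ G := (Finset.mem_filter.1 hl).2
      have hs : ∀ q : ℚ, (q : ℝ) = l.1 → ¬ (|q.num| ≤ H ∧ q.den ≤ H) := by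
        intro q hq hqH
        apply hlG
        rw [← hq]
        exact CappedSlopeSum.mem_lowSlopes H q hqH.1 hqH.2
      -- transport to lattice points
      set A' : Finset (ℕ × ℕ) := ((Finset.range n) ×ˢ (Finset.range n)).filter
        (fun x : ℕ × ℕ => (x.2 : ℝ) = l.1 * (x.1 : ℝ) + l.2) with hA'
      have hA'b : A'.card ≤ (n - 1) / (H + 1) + 1 := by
        refine CappedSlopeSum.card_linePts_le n H l.1 l.2 A' (fun x hx => ?_) hs
        simp only [hA', Finset.mem_filter, Finset.mem_product, Finset.mem_range] at hx
        exact ⟨hx.1.1, hx.1.2, hx.2⟩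
      have hsub : ((A ×ˢ A).filter fun x : ℝ × ℝ => x.2 = l.1 * x.1 + l.2) ⊆
          A'.image (fun x : ℕ × ℕ => ((x.1 : ℝ), (x.2 : ℝ))) := by
        intro x hx
        simp only [Finset.mem_filter, Finset.mem_product, hAdef, Finset.mem_image, Finset.mem_range] at hx
        obtain ⟨⟨⟨i, hi, hix⟩, ⟨j, hj, hjx⟩⟩, heq⟩ := hx
        refine Finset.mem_image.2 ⟨(i, j), ?_, ?_⟩
        · simp only [hA', Finset.mem_filter, Finset.mem_product, Finset.mem_range]
          refine ⟨⟨hi, hj⟩, ?_⟩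
          rw [hix, hjx]; exact heq
        · exact Prod.ext hix hjx
      calc F l ≤ (A'.image (fun x : ℕ × ℕ => ((x.1 : ℝ), (x.2 : ℝ)))).card := Finset.card_le_card hsub
        _ ≤ A'.card := Finset.card_image_le
        _ ≤ (n - 1) / (H + 1) + 1 := hA'b
    calc ∑ l ∈ L.filter (fun l => ¬ l.1 ∈ G), F l
        ≤ ∑ _l ∈ L.filter (fun l => ¬ l.1 ∈ G), ((n - 1) / (H + 1) + 1) := Finset.sum_le_sum hper
      _ = (L.filter (fun l => ¬ l.1 ∈ G)).card * ((n - 1) / (H + 1) + 1) := by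
          rw [Finset.sum_const, smul_eq_mul]
      _ ≤ L.card * ((n - 1) / (H + 1) + 1) := Nat.mul_le_mul_right _ (Finset.card_filter_le _ _)
  rw [hsplit]
  exact Nat.add_le_add hlow hhigh

end

end Summit.ValiantsHypothesis.ValiantsHypothesis.Theorems.NewtonFramesNewtonTauWeak.LowParallelism
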